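import Mathlib
import Literature.Probability.Percolation.PercolationProofs
import Literature.Probability.LatticeModels.ProdBernoulliIndependence
import Literature.Probability.LatticeModels.ProdBernoulliClusterLocality
import Literature.Probability.LatticeModels.ProdBernoulliCoupling
import Literature.Probability.Percolation.ConditionalPositiveAssociation
import Literature.Probability.Percolation.KozmaNitzanPinning
import Summits.CriticalPhenomena.PercolationContinuityZ3.Theorems.PercNearOneGluingNearOneGluingKnLemma3i
import Summits.CriticalPhenomena.PercolationContinuityZ3.Theorems.PercNearOneGluingNearOneGluingWeightContinuity
import HarnessLib

/-! # Crux `PercNearOneGluing.AdditiveGluing` (stmt-CriticalPhenomena-4576), line `sigma-recursion-lemma5-any-relay` — stub `stub_gluingLemma5`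

Helper file for the crux skeleton `Cruxes/AdditiveGluing/Lines/sigma-recursion-lemma5-any-relay.lean`
(lead prover-line-stmt-CriticalPhenomena-4576-0).  Proves exactly the registered stub signature;
lands with `--supports stmt-CriticalPhenomena-4576`.

## Content

Kozma–Nitzan, arXiv:2401.12397, **Lemma 5** (p. 13) for an ARBITRARY relay `a`, in block form,
on the weighted complete graph `Fin n` (`μ_w = prodBernoulli w` on `Set (Sym2 (Fin n))`):
if `μ_w(a ↔ b) ≤ μ_w(v ↔ b)` with `v ∈ S ∌ b`, then after GLUING the block `S` (weight `1` on
every non-loop pair inside `S`, `glue w S`) one has `μ_glue(a ↔ b) ≤ μ_glue(S ↔ b)`.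

## Proof (KN p. 13, with the block `S` in place of `0 ∪ B`)

Let `D` be the set of non-loop pairs inside `S` and `E = {D ⊆ ω}` ("all of `D` open").
* Sprinkling.  For `ε ∈ [0, 1]` put `w_ε e = (1 - ε) w e + ε` on `D` (Mathlib's
  `Set.Icc.convexComb (w e) 1 ε`) and `w_ε = w` off `D`; `w ≤ w_ε`, `w_0 = w`, `ε ↦ w_ε` is
  continuous, and `w_ε ≥ ε > 0` on `D` for `ε > 0`.  By the monotone coupling
  (`prodBernoulli_real_mono_of_isUpperSet`) `μ_{w_ε}(a ↔ b) ≤ μ_{w_ε}(v ↔ b) + d(ε)` with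
  `d(ε) = μ_{w_ε}(a ↔ b) - μ_w(a ↔ b) ≥ 0`, and `d(ε) → 0` as `ε → 0` by continuity in the
  weights (`stub_weightContinuity`).
* `E` is increasing and determined by the open edge cluster `C_v` in the sense of
  van den Berg–Häggström–Kahn (every pair of `D` is open, non-loop, with both ends joined to `v`
  inside the open clique `S`, so `D ⊆ C_v(ω) ⊆ C_v(ω') ⊆ ω'`), hence KN Lemma 3(i)
  (`knLemma3i`, PROVED in the tree from BHK 2006 Thms 1.3–1.4) gives
  `μ_{w_ε}({a ↔ b} ∩ E) ≤ μ_{w_ε}({v ↔ b} ∩ E) + d(ε) μ_{w_ε}(E)`.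
* Conditioning a product measure on "all of `D` open" is gluing:
  `μ_u(X ∩ E) = μ_u(E) · μ_{glue}(X)` (`E` is the cylinder `[D]_D` and the pinned weighting
  `pinW u D D` is the glued one; `prodBernoulli_real_inter_localCylinder`), and
  `μ_{w_ε}(E) = ∏_{e ∈ D} w_ε e > 0`.  Dividing, `μ_glue(a ↔ b) ≤ μ_glue(v ↔ b) + d(ε)` for
  every `ε > 0`; let `ε = 1/(k+1) → 0`, and use `{v ↔ b} ⊆ ⋃_{s ∈ S} {s ↔ b}`.
-/

namespace Summit.CriticalPhenomena.PercolationContinuityZ3.Theorems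

open MeasureTheory Set
open Literature.Probability.LatticeModels (prodBernoulli)
open Literature.Probability.Percolation (BondConfig openConn openGraph)

noncomputable section
open Classical

section GluingLemma5Aux

open Filter Topology
open Literature.Probability.LatticeModels Literature.Probability.Percolation

/-- **Conditioning on "all coordinates of `D` open" is gluing `D`**: for every finite `D`,
every weighting `p` and every measurable event `X`,
`P_p(X ∩ {D ⊆ ω}) = P_p({D ⊆ ω}) · P_{glue}(X)`, where the glued weighting is `1` on `D` and `p`
elsewhere (the cylinder `[D]_D` and the pinned weighting `pinW p D D` of
`prodBernoulli_real_inter_localCylinder`).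
[cite: KozmaNitzan2024, §3.2 p. 13 (proof of Lemma 5, "independence from σ")] -/
theorem gluingLemma5_real_inter_allOpen {ι : Type*} [DecidableEq ι] (p : ι → unitInterval)
    (D : Finset ι) {X : Set (Set ι)} (hX : MeasurableSet X) :
    (prodBernoulli p).real (X ∩ {ω | (↑D : Set ι) ⊆ ω}) =
      (prodBernoulli p).real {ω | (↑D : Set ι) ⊆ ω} *
        (prodBernoulli (fun i => if i ∈ D then 1 else p i)).real X := by
  have hcyl : localCylinder (↑D : Set ι) ↑D = {ω | (↑D : Set ι) ⊆ ω} := by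
    ext ω
    simp only [localCylinder, Set.mem_setOf_eq, Set.subset_def, Finset.mem_coe]
    exact forall₂_congr fun i hi => ⟨fun h => h.2 hi, fun h => iff_of_true h hi⟩
  have hpin : pinW p ↑D ↑D = fun i => if i ∈ D then 1 else p i := by
    funext i
    by_cases hi : i ∈ D
    · rw [pinW_apply_of_mem_of_mem p (Finset.mem_coe.2 hi) (Finset.mem_coe.2 hi), if_pos hi]
    · rw [pinW_apply_of_not_mem p _ (fun h => hi (Finset.mem_coe.1 h)), if_neg hi]
  rw [← hcyl, prodBernoulli_real_inter_localCylinder p D ↑D hX, hpin]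

/-- The event "all pairs of `D` are open", `D` the non-loop pairs inside a block `S ∋ v`, is
increasing in the open edge cluster `C_v` (every pair of `D` is open, non-loop, with both ends
joined to `v` inside the open clique `S`).  (KN p. 14: "`E` … is `C_b`-monotone".)
[cite: KozmaNitzan2024, §3.2 p. 14] -/
theorem gluingLemma5_allOpen_mono {n : ℕ} {S : Finset (Fin n)} {D : Finset (Sym2 (Fin n))}
    (hD : ∀ e, e ∈ D ↔ (∀ x ∈ e, x ∈ S) ∧ ¬ e.IsDiag) {v : Fin n} (hv : v ∈ S) :
    ∀ ω ω' : Set (Sym2 (Fin n)),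
      ω ∈ {ω : Set (Sym2 (Fin n)) | (↑D : Set (Sym2 (Fin n))) ⊆ ω} →
        openEdgeCluster ω v ⊆ openEdgeCluster ω' v →
          ω' ∈ {ω : Set (Sym2 (Fin n)) | (↑D : Set (Sym2 (Fin n))) ⊆ ω} := by
  intro ω ω' hω hsub e heD
  have he := (hD e).1 (Finset.mem_coe.1 heD)
  refine openEdgeCluster_subset ω' v (hsub ?_)
  rw [mem_openEdgeCluster_iff]
  refine ⟨hω heD, he.2, fun x hx => ?_⟩
  have hxS : x ∈ S := he.1 x hx
  by_cases hxv : x = v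
  · subst hxv
    exact SimpleGraph.Reachable.refl _
  · have hvx : s(v, x) ∈ D := by
      refine (hD _).2 ⟨fun y hy => ?_, fun h => hxv (Sym2.mk_isDiag_iff.1 h).symm⟩
      rcases Sym2.mem_iff.1 hy with rfl | rfl
      exacts [hv, hxS]
    exact ((openGraph_adj ω v x).2 ⟨hω (Finset.mem_coe.2 hvx), Ne.symm hxv⟩).reachable

/-- A sequence in `(0, 1]` tending to `0` in `[0, 1]`: `ε_k = 1 / (k + 1)`. [folklore] -/
theorem gluingLemma5_exists_seq_tendsto_zero :
    ∃ ε : ℕ → unitInterval, (∀ k, 0 < (ε k : ℝ)) ∧ Tendsto ε atTop (𝓝 0) := by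
  refine ⟨fun k => ⟨1 / ((k : ℝ) + 1), unitInterval.div_mem zero_le_one (by positivity)
    (by linarith [(k.cast_nonneg : (0 : ℝ) ≤ k)])⟩, fun k => ?_, ?_⟩
  · show (0 : ℝ) < 1 / ((k : ℝ) + 1)
    positivity
  · rw [tendsto_subtype_rng]
    exact tendsto_one_div_add_atTop_nhds_zero_nat

end GluingLemma5Aux

open Filter Topology Literature.Probability.LatticeModels Literature.Probability.Percolation in
/-- Registered stub `stub_gluingLemma5` of crux stmt-CriticalPhenomena-4576 (line
sigma-recursion-lemma5-any-relay): **KN Lemma 5 for an arbitrary relay, block form** — if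
`P_w(a ↔ b) ≤ P_w(v ↔ b)` with `v ∈ S ∌ b`, then after gluing `S`,
`P_{glue w S}(a ↔ b) ≤ P_{glue w S}(S ↔ b)`.  See the module docstring for the proof.
[cite: KozmaNitzan2024, §3.2 Lemma 5 (p. 13)] -/
theorem stub_gluingLemma5 :
    ∀ (n : ℕ) (w : Sym2 (Fin n) → unitInterval) (S : Finset (Fin n)) (a v b : Fin n),
      v ∈ S → b ∉ S →
      (prodBernoulli w).real (openConn a b) ≤ (prodBernoulli w).real (openConn v b) →
      (prodBernoulli (fun e : Sym2 (Fin n) =>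
          if (∀ x ∈ e, x ∈ S) ∧ ¬ e.IsDiag then 1 else w e)).real (openConn a b) ≤
        (prodBernoulli (fun e : Sym2 (Fin n) =>
          if (∀ x ∈ e, x ∈ S) ∧ ¬ e.IsDiag then 1 else w e)).real (⋃ s ∈ S, openConn s b)
    := by
  intro n w S a v b hvS _hbS hle
  set g : Sym2 (Fin n) → unitInterval :=
    fun e => if (∀ x ∈ e, x ∈ S) ∧ ¬ e.IsDiag then 1 else w e with hg
  -- it suffices to compare with `v`: `{v ↔ b} ⊆ {S ↔ b}`
  refine le_trans ?_
    (measureReal_mono (fun ω hω => Set.mem_iUnion₂.2 ⟨v, hvS, hω⟩) (measure_ne_top _ _))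
  -- `D` = non-loop pairs inside `S`, `E` = all of them open
  set D : Finset (Sym2 (Fin n)) :=
    Finset.univ.filter (fun e => (∀ x ∈ e, x ∈ S) ∧ ¬ e.IsDiag) with hDdef
  have hD : ∀ e, e ∈ D ↔ (∀ x ∈ e, x ∈ S) ∧ ¬ e.IsDiag := fun e => by simp [hDdef]
  set E : Set (BondConfig (Fin n)) := {ω | (↑D : Set (Sym2 (Fin n))) ⊆ ω} with hEdef
  -- the sprinkled weights `w_ε`
  set u : unitInterval → Sym2 (Fin n) → unitInterval :=
    fun ε e => if e ∈ D then Set.Icc.convexComb (w e) 1 ε else w e with hu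
  have hwu : ∀ ε, w ≤ u ε := by
    intro ε e
    by_cases he : e ∈ D
    · simp only [hu, he, if_true]
      exact Set.Icc.le_convexComb unitInterval.le_one' ε
    · simp only [hu, he, if_false]
      exact le_rfl
  have hu0 : u 0 = w := by
    funext e
    by_cases he : e ∈ D
    · simp only [hu, he, if_true, Set.Icc.convexComb_zero]
    · simp only [hu, he, if_false]
  have hucont : Continuous u := by
    refine continuous_pi fun e => ?_
    by_cases he : e ∈ D
    · simp only [hu, he, if_true]
      exact Set.Icc.continuous_convexComb (w e) 1
    · simp only [hu, he, if_false]
      exact continuous_const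
  -- gluing `u ε` along `D` gives `g`, whatever `ε`
  have hpin : ∀ ε, (fun e => if e ∈ D then (1 : unitInterval) else u ε e) = g := by
    intro ε
    funext e
    by_cases he : e ∈ D
    · simp only [hg, he, if_true, if_pos ((hD e).1 he)]
    · have he' : ¬ ((∀ x ∈ e, x ∈ S) ∧ ¬ e.IsDiag) := fun h => he ((hD e).2 h)
      simp only [hg, hu, he, if_false, if_neg he']
  -- conditioning on `E` is gluing
  have hcond : ∀ ε (X : Set (BondConfig (Fin n))),
      (prodBernoulli (u ε)).real (X ∩ E) =
        (prodBernoulli (u ε)).real E * (prodBernoulli g).real X := by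
    intro ε X
    rw [hEdef, gluingLemma5_real_inter_allOpen (u ε) D MeasurableSet.of_discrete, hpin ε]
  -- `E` has positive probability under `u ε`, `ε > 0`
  have hpos : ∀ ε : unitInterval, 0 < (ε : ℝ) → 0 < (prodBernoulli (u ε)).real E := by
    intro ε hε
    rw [hEdef, prodBernoulli_real_subset (u ε) D]
    refine Finset.prod_pos fun e he => ?_
    simp only [hu, he, if_true, Set.Icc.coe_convexComb, Set.Icc.coe_one, mul_one]
    exact add_pos_of_nonneg_of_pos
      (mul_nonneg (unitInterval.one_minus_nonneg ε) (unitInterval.nonneg (w e))) hε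
  -- the step at fixed `ε > 0`
  have hstep : ∀ ε : unitInterval, 0 < (ε : ℝ) →
      (prodBernoulli g).real (openConn a b) ≤ (prodBernoulli g).real (openConn v b) +
        ((prodBernoulli (u ε)).real (openConn a b) - (prodBernoulli w).real (openConn a b)) := by
    intro ε hε
    have hma : (prodBernoulli w).real (openConn a b) ≤ (prodBernoulli (u ε)).real (openConn a b) :=
      prodBernoulli_real_mono_of_isUpperSet (hwu ε) (isUpperSet_openConn a b)
        MeasurableSet.of_discrete
    have hmv : (prodBernoulli w).real (openConn v b) ≤ (prodBernoulli (u ε)).real (openConn v b) :=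
      prodBernoulli_real_mono_of_isUpperSet (hwu ε) (isUpperSet_openConn v b)
        MeasurableSet.of_discrete
    have h3 := knLemma3i n (u ε) a v b E
      ((prodBernoulli (u ε)).real (openConn a b) - (prodBernoulli w).real (openConn a b))
      (gluingLemma5_allOpen_mono hD hvS) (sub_nonneg.2 hma) (by linarith)
    rw [hcond ε (openConn a b), hcond ε (openConn v b)] at h3
    refine le_of_mul_le_mul_left (h3.trans_eq ?_) (hpos ε hε)
    ring
  -- `ε → 0`
  obtain ⟨ε, hεpos, hεlim⟩ := gluingLemma5_exists_seq_tendsto_zero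
  have hF : Continuous fun t : unitInterval => (prodBernoulli (u t)).real (openConn a b) :=
    (stub_weightContinuity n (openConn a b)).comp hucont
  have hlim : Tendsto (fun k => (prodBernoulli g).real (openConn v b) +
      ((prodBernoulli (u (ε k))).real (openConn a b) - (prodBernoulli w).real (openConn a b)))
      atTop (𝓝 ((prodBernoulli g).real (openConn v b) +
        ((prodBernoulli (u 0)).real (openConn a b) - (prodBernoulli w).real (openConn a b)))) :=
    tendsto_const_nhds.add (((hF.tendsto 0).comp hεlim).sub tendsto_const_nhds)
  rw [hu0, sub_self, add_zero] at hlim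
  exact ge_of_tendsto' hlim fun k => hstep (ε k) (hεpos k)

end

end Summit.CriticalPhenomena.PercolationContinuityZ3.Theorems
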